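import Summits.AtomisticToContinuum.Crystallization.Theorems.ExcessDecayLiouvilleMatching
import Summits.AtomisticToContinuum.Crystallization.Theorems.ExcessDecayLiouvilleForceTail
import Summits.AtomisticToContinuum.Crystallization.Theorems.ExcessDecayLiouvilleLinearisation

/-!
# Route `ExcessDecayLiouville`: size of the terms of the linearised force equation

Companion of `ExcessDecayLiouvilleLinearisedEquation.lean` (step (a)/(b) of the excess-decay argument for
item `ExcessDecay`, stmt-AtomisticToContinuum-9334).  With `SR` the (finite) set of sites of the ball
`dist · c ≤ r`, `s ∈ SR`, displacement `|u| ≤ ε` and matching `π`: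

* `norm_forceConst_apply_le` : the force-constant map is `O(|e|⁻⁸)`:
  `‖h(|e|²)w + 2⟪e,w⟫h′(|e|²)e‖ ≤ 38|e|⁻⁸|w|` for `|e| ≥ 9/10`;
* `sum_inv_pow_sites_le` : `Σ_{s' ∈ SR ∖ s} |s − s'|^{-(k+3)} ≤ 1024/((23/25)³(23/25)ᵏ)` (`k ≥ 1`);
* `norm_truncOperator_le` : `‖(L_r u)(s)‖ ≤ 76 ε Σ_{s'} |s−s'|⁻⁸ ≤ 152000 ε`  (row-sum bound);
* `dist_rest_ge` : a particle of `X` not matched to a site of the punctured ball is at distance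
  `≥ r − dist s c − 2ε` from `π s` (via `matching_surjOn`), whence
* `sum_norm_rest_le` : the exterior force obeys `Σ_{q ∈ Rest} ‖f(π s, q)‖ ≤ 2048/(δ³R⁴)`, `R = r − dist s c − 2ε ≥ 1 ∨ δ`.

All `[folklore]`; helper lemmas, nothing here closes an item.
-/

noncomputable section

namespace Summit.AtomisticToContinuum.Crystallization.Theorems.ExcessDecayLiouville

open scoped BigOperators Topology InnerProductSpace RealInnerProductSpace
open Literature.MathematicalPhysics.StatisticalMechanics
open Summit.AtomisticToContinuum.Crystallization.Theorems.PhononStabilityNegative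

/-- **The force-constant map is `O(|e|⁻⁸)`**: `‖h(|e|²)w + (2⟪e,w⟫h′(|e|²))e‖ ≤ 38·|e|⁻⁸·|w|` for
`|e| ≥ 9/10` (`|h(x)| ≤ |e|⁻¹⁴ + |e|⁻⁸`, `2|e|²|h′(x)| ≤ 14|e|⁻¹⁴ + 8|e|⁻⁸`, `|e|⁻⁶ ≤ (10/9)⁶`). [folklore] -/
theorem norm_forceConst_apply_le {e : EuclideanSpace ℝ (Fin 3)} (he : 9 / 10 ≤ ‖e‖) (w : EuclideanSpace ℝ (Fin 3)) :
    ‖(-((‖e‖ ^ 2)⁻¹) ^ 7 + ((‖e‖ ^ 2)⁻¹) ^ 4) • w +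
        (2 * ⟪e, w⟫ * (7 * ((‖e‖ ^ 2)⁻¹) ^ 8 - 4 * ((‖e‖ ^ 2)⁻¹) ^ 5)) • e‖ ≤ 38 * (‖e‖⁻¹) ^ 8 * ‖w‖ := by
  have he0 : 0 < ‖e‖ := by linarith
  set u := ‖e‖⁻¹ with hu
  have hu0 : 0 < u := inv_pos.2 he0
  have hue : u * ‖e‖ = 1 := by rw [hu, inv_mul_cancel₀ he0.ne']
  have hei : u ≤ 10 / 9 := by rw [hu, inv_le_comm₀ he0 (by norm_num)]; linarith
  have hxi : (‖e‖ ^ 2)⁻¹ = u ^ 2 := by rw [hu, inv_pow]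
  rw [hxi]
  have hcs : |⟪e, w⟫| ≤ ‖e‖ * ‖w‖ := abs_real_inner_le_norm e w
  have hw0 : 0 ≤ ‖w‖ := norm_nonneg w
  have hu6 : u ^ 6 ≤ (10 / 9) ^ 6 := pow_le_pow_left₀ hu0.le hei 6
  -- first term
  have h1 : ‖(-(u ^ 2) ^ 7 + (u ^ 2) ^ 4) • w‖ ≤ 3 * u ^ 8 * ‖w‖ := by
    rw [norm_smul, Real.norm_eq_abs]
    refine mul_le_mul_of_nonneg_right ?_ hw0
    have h14 : (u ^ 2) ^ 7 = u ^ 8 * u ^ 6 := by ring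
    have h8 : (u ^ 2) ^ 4 = u ^ 8 := by ring
    rw [h14, h8]
    have hu8 : 0 < u ^ 8 := pow_pos hu0 8
    refine abs_le.2 ⟨?_, ?_⟩ <;> nlinarith [mul_le_mul_of_nonneg_left hu6 hu8.le, pow_pos hu0 6]
  -- second term
  have h2 : ‖(2 * ⟪e, w⟫ * (7 * (u ^ 2) ^ 8 - 4 * (u ^ 2) ^ 5)) • e‖ ≤ 35 * u ^ 8 * ‖w‖ := by
    rw [norm_smul, Real.norm_eq_abs, abs_mul, abs_mul, abs_two]
    have hfac : |7 * (u ^ 2) ^ 8 - 4 * (u ^ 2) ^ 5| ≤ 7 * u ^ 16 + 4 * u ^ 10 := by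
      have e16 : (u ^ 2) ^ 8 = u ^ 16 := by ring
      have e10 : (u ^ 2) ^ 5 = u ^ 10 := by ring
      rw [e16, e10]
      refine abs_le.2 ⟨?_, ?_⟩ <;> nlinarith [pow_pos hu0 16, pow_pos hu0 10]
    calc 2 * |⟪e, w⟫| * |7 * (u ^ 2) ^ 8 - 4 * (u ^ 2) ^ 5| * ‖e‖
        ≤ 2 * (‖e‖ * ‖w‖) * (7 * u ^ 16 + 4 * u ^ 10) * ‖e‖ := by gcongr
      _ = 2 * ‖w‖ * (7 * (u ^ 8 * u ^ 6) + 4 * u ^ 8) * (u * ‖e‖) ^ 2 := by ring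
      _ = 2 * ‖w‖ * (7 * (u ^ 8 * u ^ 6) + 4 * u ^ 8) := by rw [hue]; ring
      _ ≤ 2 * ‖w‖ * (7 * (u ^ 8 * (10 / 9) ^ 6) + 4 * u ^ 8) := by gcongr
      _ = (2 * (7 * (10 / 9) ^ 6 + 4)) * u ^ 8 * ‖w‖ := by ring
      _ ≤ 35 * u ^ 8 * ‖w‖ := by gcongr; norm_num
  calc _ ≤ ‖(-(u ^ 2) ^ 7 + (u ^ 2) ^ 4) • w‖ + ‖(2 * ⟪e, w⟫ * (7 * (u ^ 2) ^ 8 - 4 * (u ^ 2) ^ 5)) • e‖ :=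
        norm_add_le _ _
    _ ≤ 3 * u ^ 8 * ‖w‖ + 35 * u ^ 8 * ‖w‖ := add_le_add h1 h2
    _ = 38 * u ^ 8 * ‖w‖ := by ring

section

variable {X : Set (EuclideanSpace ℝ (Fin 3))} {c : EuclideanSpace ℝ (Fin 3)} {r ε δ : ℝ}
  {t : Fin 2 → EuclideanSpace ℝ (Fin 3)} {A : EuclideanSpace ℝ (Fin 3) →L[ℝ] EuclideanSpace ℝ (Fin 3)}
  {π : EuclideanSpace ℝ (Fin 3) → EuclideanSpace ℝ (Fin 3)}

/-- **Lattice sums over the sites of a ball**: `Σ_{s' ∈ SR ∖ s} |s − s'|^{-(k+3)} ≤ 1024/((23/25)³(23/25)ᵏ)`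
for a site `s` (sites are `23/25`-separated; `sum_inv_pow_le_of_separated`). [folklore] -/
theorem sum_inv_pow_sites_le (hA : Adm₀ A) (hI : Inner₀ t A) {s : EuclideanSpace ℝ (Fin 3)}
    (hs : s ∈ Sites₀ t A) (SR : Finset (EuclideanSpace ℝ (Fin 3))) (hSR : ∀ x ∈ SR, x ∈ Sites₀ t A)
    {k : ℕ} (hk : 1 ≤ k) :
    ∑ s' ∈ SR.erase s, (‖s - s'‖⁻¹) ^ (k + 3) ≤ 1024 / ((23 / 25 : ℝ) ^ 3 * (23 / 25 : ℝ) ^ k) := by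
  have h := sum_inv_pow_le_of_separated (SR.erase s) s (k := k) hk (by norm_num : (0 : ℝ) < 23 / 25) le_rfl
    (fun a ha b hb hab => dist_sites_ge hA hI (hSR a (Finset.mem_of_mem_erase ha))
      (hSR b (Finset.mem_of_mem_erase hb)) hab)
    (fun a ha => dist_sites_ge hA hI (hSR a (Finset.mem_of_mem_erase ha)) hs (Finset.ne_of_mem_erase ha))
  refine le_trans (le_of_eq (Finset.sum_congr rfl fun s' _ => ?_)) h
  rw [dist_eq_norm, norm_sub_rev]

/-- **Row-sum bound for the truncated force-constant operator**: if `|u| ≤ ε` on `SR` then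
`‖Σ_{s' ∈ SR∖s} K(s−s')(u s − u s')‖ ≤ 76 ε Σ_{s'} |s−s'|⁻⁸`. [folklore] -/
theorem norm_truncOperator_le (hA : Adm₀ A) (hI : Inner₀ t A) {s : EuclideanSpace ℝ (Fin 3)}
    (hs : s ∈ Sites₀ t A) (SR : Finset (EuclideanSpace ℝ (Fin 3))) (hSR : ∀ x ∈ SR, x ∈ Sites₀ t A)
    (hsSR : s ∈ SR) (u : EuclideanSpace ℝ (Fin 3) → EuclideanSpace ℝ (Fin 3)) (hε : ∀ x ∈ SR, ‖u x‖ ≤ ε) :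
    ‖∑ s' ∈ SR.erase s,
        ((-((‖s - s'‖ ^ 2)⁻¹) ^ 7 + ((‖s - s'‖ ^ 2)⁻¹) ^ 4) • (u s - u s') +
          (2 * ⟪s - s', u s - u s'⟫ * (7 * ((‖s - s'‖ ^ 2)⁻¹) ^ 8 - 4 * ((‖s - s'‖ ^ 2)⁻¹) ^ 5)) • (s - s'))‖ ≤
      76 * ε * ∑ s' ∈ SR.erase s, (‖s - s'‖⁻¹) ^ 8 := by
  refine (norm_sum_le _ _).trans ?_
  rw [Finset.mul_sum]
  refine Finset.sum_le_sum fun s' hs' => ?_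
  have hs'S := hSR s' (Finset.mem_of_mem_erase hs')
  have hne := Finset.ne_of_mem_erase hs'
  have he : 9 / 10 ≤ ‖s - s'‖ := by
    rw [← dist_eq_norm]; linarith [dist_sites_ge hA hI hs hs'S hne.symm]
  have hw : ‖u s - u s'‖ ≤ 2 * ε := by
    calc ‖u s - u s'‖ ≤ ‖u s‖ + ‖u s'‖ := norm_sub_le _ _
      _ ≤ ε + ε := add_le_add (hε s hsSR) (hε s' (Finset.mem_of_mem_erase hs'))
      _ = 2 * ε := by ring
  refine (norm_forceConst_apply_le he (u s - u s')).trans ?_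
  have h8 : 0 ≤ (‖s - s'‖⁻¹) ^ 8 := by positivity
  calc 38 * (‖s - s'‖⁻¹) ^ 8 * ‖u s - u s'‖ ≤ 38 * (‖s - s'‖⁻¹) ^ 8 * (2 * ε) := by gcongr
    _ = 76 * ε * (‖s - s'‖⁻¹) ^ 8 := by ring

/-- **Unmatched particles are far.**  If every particle of the ball `dist · c ≤ r` is within `ε` of a
site (`hX`), the matching `π` serves the sites of the ball (`hπ`), `0 ≤ 2ε < δ` (`X` `δ`-separated), then a
particle `q ∈ X` which is not `π s'` for any site `s'` of the ball satisfies `dist q c > r − ε`, hence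
`dist q (π s) ≥ r − dist s c − 2ε` for every site `s` of the ball. [folklore] -/
theorem dist_rest_ge (hsep : ∀ p ∈ X, ∀ q ∈ X, p ≠ q → δ ≤ dist p q) (hε0 : 0 ≤ ε) (hε : 2 * ε < δ)
    (hX : ∀ p ∈ X, dist p c ≤ r → ∃ m : Fin 2, ∃ z ∈ Λ₀, dist p (t m + A z) ≤ ε)
    (hπ : ∀ s' ∈ Sites₀ t A, dist s' c ≤ r → π s' ∈ X ∧ dist (π s') s' ≤ ε)
    {s : EuclideanSpace ℝ (Fin 3)} (hs : s ∈ Sites₀ t A) (hsc : dist s c ≤ r)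
    {q : EuclideanSpace ℝ (Fin 3)} (hq : q ∈ X)
    (hnot : ∀ s' ∈ Sites₀ t A, dist s' c ≤ r → π s' ≠ q) :
    r - dist s c - 2 * ε ≤ dist q (π s) := by
  have hqc : r - ε < dist q c := by
    by_contra h
    push Not at h
    obtain ⟨s', hs', hs'c, hπq⟩ := matching_surjOn hsep hε0 hε hX hπ hq h
    exact hnot s' hs' hs'c hπq
  have hps : dist (π s) s ≤ ε := (hπ s hs hsc).2
  have h1 := dist_triangle q (π s) c
  have h2 := dist_triangle (π s) s c
  linarith

/-- **The exterior force is small**: with `R := r − dist s c − 2ε ≥ max δ 1`, the forces on `π s` from the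
particles of a finite set `Rest ⊆ X` none of which is matched to a site of the ball sum to
`≤ 2048/(δ³R⁴)` in norm. [folklore] -/
theorem sum_norm_rest_le (hsep : ∀ p ∈ X, ∀ q ∈ X, p ≠ q → δ ≤ dist p q) (hδ : 0 < δ) (hε0 : 0 ≤ ε)
    (hε : 2 * ε < δ)
    (hX : ∀ p ∈ X, dist p c ≤ r → ∃ m : Fin 2, ∃ z ∈ Λ₀, dist p (t m + A z) ≤ ε)
    (hπ : ∀ s' ∈ Sites₀ t A, dist s' c ≤ r → π s' ∈ X ∧ dist (π s') s' ≤ ε)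
    {s : EuclideanSpace ℝ (Fin 3)} (hs : s ∈ Sites₀ t A) (hsc : dist s c ≤ r)
    (hR1 : 1 ≤ r - dist s c - 2 * ε) (hRδ : δ ≤ r - dist s c - 2 * ε)
    (Rest : Finset (EuclideanSpace ℝ (Fin 3))) (hRestX : ∀ q ∈ Rest, q ∈ X)
    (hRest : ∀ q ∈ Rest, ∀ s' ∈ Sites₀ t A, dist s' c ≤ r → π s' ≠ q) :
    ∑ q ∈ Rest, ‖(deriv lennardJones (dist (π s) q) / dist (π s) q) • (π s - q)‖ ≤
      2048 / (δ ^ 3 * (r - dist s c - 2 * ε) ^ 4) :=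
  sum_norm_ljForce_le_of_separated Rest (π s) hδ hRδ hR1
    (fun a ha b hb hab => hsep a (hRestX a ha) b (hRestX b hb) hab)
    (fun q hq => dist_rest_ge hsep hε0 hε hX hπ hs hsc (hRestX q hq) (hRest q hq))

end

end Summit.AtomisticToContinuum.Crystallization.Theorems.ExcessDecayLiouville

end
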